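import Summits.ValiantsHypothesis.ValiantsHypothesis.Theses.DivisionGap
import Literature.Computability.AlgebraicComplexity.PermanentIrreducible
import Literature.Computability.AlgebraicComplexity.StandardFamiliesProofs
import Literature.Computability.AlgebraicComplexity.MonotoneStructure

/-!
# `DivisionGap.PerDivisionHard` (stmt-ValiantsHypothesis-5065): the Boolean shadow of a monotone
multiple — which multipliers `h` the Boolean transfer reaches, and where it is void

Standing-disprover bookkeeping for the crux `PerDivisionHard` (monotone pairs `g = per_n · h`, `h`).
A monotone arithmetic circuit for `g ∈ ℝ≥0[x]` becomes, under `+ ↦ ∨`, `× ↦ ∧`, positive constants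
`↦ ⊤`, a monotone Boolean circuit of the same size for the *Boolean shadow*
`S ↦ ∃ m ∈ supp g, supp m ⊆ S` of `g`.  For the pairs of the crux this shadow is (all inline, no
definitions; variables doubly indexed as in the crux, no-cancellation via the tree's
`add_mem_support_mul`):

* `shadow_mul_iff_of_coeff_zero_ne_zero` — if `h` has a nonzero constant term then `f · h` and `f`
  have the same shadow (over `ℝ≥0`, any `f`): the transfer then hands `per_n · h` the monotone Boolean
  complexity of PERFECT MATCHING (`shadow_perPoly_mul_iff`: the shadow of `per_n · h` accepts `S` iff
  `S` contains a permutation pattern), i.e. Razborov's `n^{Ω(log n)}` — quasi-polynomial only, so it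
  cannot serve the crux from `c = 2` on even for these `h`.
* `shadow_mul_prod_X_iff` — for `h = ∏_v x_v` (no constant term) the shadow of `f · h` is the trivial
  function "`S` = everything" whatever `f` is: the transfer is void (Hrubeš–Yehudayoff 2021, Rem. 45–46,
  for powers and products).  Multipliers without constant term are exactly where a refutation of the
  crux — or a new lower-bound idea — has to live.
-/

noncomputable section

namespace Summit.ValiantsHypothesis.Theorems.PerDivisionHardNegative

open Literature.Computability.AlgebraicComplexity MvPolynomial
open scoped NNReal

section Shadow

variable {ι κ : Type} [DecidableEq ι] [DecidableEq κ]

omit [DecidableEq ι] [DecidableEq κ] in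
/-- Exponent vectors over `ℕ` do not cancel: `supp m₁ ⊆ supp (m₁ + m₂)`. [folklore] -/
theorem support_subset_support_add (m₁ m₂ : ι × κ →₀ ℕ) : m₁.support ⊆ (m₁ + m₂).support := by
  intro v hv
  rw [Finsupp.mem_support_iff] at hv ⊢
  rw [Finsupp.add_apply]
  omega

/-- **Constant term present: the shadow of `f · h` is the shadow of `f`.** Over `ℝ≥0`, if
`coeff 0 h ≠ 0` then for every `S`:
`(∃ m ∈ supp (f h), supp m ⊆ S) ↔ (∃ m ∈ supp f, supp m ⊆ S)`. [folklore] -/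
theorem shadow_mul_iff_of_coeff_zero_ne_zero {f h : MvPolynomial (ι × κ) ℝ≥0} (h0 : coeff 0 h ≠ 0)
    (S : Finset (ι × κ)) :
    (∃ m ∈ (f * h).support, m.support ⊆ S) ↔ ∃ m ∈ f.support, m.support ⊆ S := by
  constructor
  · rintro ⟨m, hm, hmS⟩
    obtain ⟨m₁, hm₁, m₂, -, rfl⟩ := Finset.mem_add.1 (support_mul f h hm)
    exact ⟨m₁, hm₁, (support_subset_support_add m₁ m₂).trans hmS⟩
  · rintro ⟨m, hm, hmS⟩
    refine ⟨m, ?_, hmS⟩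
    have h0' : (0 : ι × κ →₀ ℕ) ∈ h.support := mem_support_iff.2 h0
    simpa using add_mem_support_mul hm h0'

/-- **No constant term can void the shadow: `h = ∏_v x_v`.** For a finite variable set and any
nonzero `f` over `ℝ≥0`, the shadow of `f · ∏_v x_v` accepts `S` iff `S` is everything. [folklore] -/
theorem shadow_mul_prod_X_iff [Fintype ι] [Fintype κ] {f : MvPolynomial (ι × κ) ℝ≥0} (hf : f ≠ 0) (S : Finset (ι × κ)) :
    (∃ m ∈ (f * ∏ v, X v).support, m.support ⊆ S) ↔ S = Finset.univ := by
  have hprod : (∏ v, X v : MvPolynomial (ι × κ) ℝ≥0) = monomial (∑ v, Finsupp.single v 1) 1 := by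
    rw [monomial_sum_one]
    rfl
  have hsupp1 : (∏ v, X v : MvPolynomial (ι × κ) ℝ≥0).support = {∑ v, Finsupp.single v 1} := by
    rw [hprod, support_monomial, if_neg one_ne_zero]
  have hfull : (∑ v, Finsupp.single v (1 : ℕ) : ι × κ →₀ ℕ).support = Finset.univ := by
    refine Finset.eq_univ_iff_forall.2 fun v => ?_
    rw [Finsupp.mem_support_iff, Finsupp.coe_finsetSum, Finset.sum_apply,
      Finset.sum_eq_single v (fun w _ hw => by simp [hw]) (fun hv => absurd (Finset.mem_univ v) hv)]
    simp
  constructor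
  · rintro ⟨m, hm, hmS⟩
    obtain ⟨m₁, -, m₂, hm₂, rfl⟩ := Finset.mem_add.1 (support_mul f _ hm)
    rw [hsupp1, Finset.mem_singleton] at hm₂
    subst hm₂
    refine Finset.eq_univ_of_forall fun v => hmS ?_
    rw [add_comm]
    exact support_subset_support_add _ _ (by rw [hfull]; exact Finset.mem_univ v)
  · rintro rfl
    obtain ⟨m₁, hm₁⟩ := support_nonempty.2 hf
    refine ⟨m₁ + ∑ v, Finsupp.single v 1, add_mem_support_mul hm₁ ?_, Finset.subset_univ _⟩
    rw [hsupp1]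
    exact Finset.mem_singleton_self _

end Shadow

section Permanent

variable {n : ℕ}

/-- The support of a permutation monomial is the permutation pattern. [folklore] -/
theorem mem_support_permMonomial (ρ : Equiv.Perm (Fin n)) (v : Fin n × Fin n) :
    v ∈ (permMonomial ρ).support ↔ ρ v.2 = v.1 := by
  obtain ⟨i, j⟩ := v
  rw [Finsupp.mem_support_iff, permMonomial_apply]
  split_ifs with h <;> simp [h]

/-- **The shadow of `per_n · h` for `h` with a constant term is PERFECT MATCHING**: it accepts `S`
iff `S ⊇ {(ρ j, j)}` for some permutation `ρ` — so the Boolean transfer gives these pairs exactly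
the monotone Boolean complexity of bipartite perfect matching (Razborov 1985: `n^{Ω(log n)}`), and no
more. [folklore] -/
theorem shadow_perPoly_mul_iff {h : MvPolynomial (Fin n × Fin n) ℝ≥0} (h0 : coeff 0 h ≠ 0)
    (S : Finset (Fin n × Fin n)) :
    (∃ m ∈ (perPoly (Fin n) ℝ≥0 * h).support, m.support ⊆ S) ↔
      ∃ ρ : Equiv.Perm (Fin n), ∀ j, (ρ j, j) ∈ S := by
  classical
  rw [shadow_mul_iff_of_coeff_zero_ne_zero h0]
  constructor
  · rintro ⟨m, hm, hmS⟩
    obtain ⟨ρ, rfl⟩ := exists_permMonomial_eq_of_coeff_perPoly_ne_zero ℝ≥0 (mem_support_iff.1 hm)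
    exact ⟨ρ, fun j => hmS ((mem_support_permMonomial ρ (ρ j, j)).2 rfl)⟩
  · rintro ⟨ρ, hρ⟩
    refine ⟨permMonomial ρ, ?_, fun v hv => ?_⟩
    · rw [mem_support_iff, coeff_permMonomial_perPoly]; exact one_ne_zero
    · obtain ⟨i, j⟩ := v
      have hij : ρ j = i := (mem_support_permMonomial ρ (i, j)).1 hv
      subst hij
      exact hρ j

/-- **… and for `h = ∏ x_ij` the shadow of `per_n · h` is void** (accepts only everything),
`n` arbitrary. [folklore] -/
theorem shadow_perPoly_mul_prod_X_iff (S : Finset (Fin n × Fin n)) :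
    (∃ m ∈ (perPoly (Fin n) ℝ≥0 * ∏ v, X v).support, m.support ⊆ S) ↔ S = Finset.univ :=
  shadow_mul_prod_X_iff (perPoly_ne_zero (Fin n) ℝ≥0) S

end Permanent

end Summit.ValiantsHypothesis.Theorems.PerDivisionHardNegative

end
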